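import Summits.QuantumFields.YangMills.Theorems.LuscherReductionOneSiteLevelsActionLipschitz

/-!
# The magnetic IMS phase of the one-site crux: `Φ_η(U) = (π/2)·clamp01(S(U)/η − 1)` (DEFINITION)
# (object posited by the VALLEY re-cut of crux `OneSiteLevels`, route `LuscherReduction`, item stmt-QuantumFields-20007; fleet lead prover ym-luscher-20007-p1)

The OUTER seam `absUpperOuter_of_valley` localises along a magnetic phase.  This file fixes the natural one: a ramp of the one-site Wilson
action `S`, equal to `0` where `S ≤ η` (valley side: `cos`-piece) and to `π/2` where `S ≥ 2η` (large fields: `sin`-piece), link-Lipschitz with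
constant `12π/η` (`Theorems/LuscherReductionOneSiteLevelsMagPhase.lean`, from `abs_wilsonAction_sub_le`).  Intended threshold `η_B = √λ_b`
(= `onePhaseScale B`), for which the IMS cost is `O(λ_b²)` and the large-field factor `e^{−B√λ_b} = e^{−2λ_b^{−5/2}}` is negligible.
-/

set_option autoImplicit false

noncomputable section

open Literature.MathematicalPhysics.QuantumFieldTheory
open Literature.MathematicalPhysics.QuantumLattice

namespace Summit.QuantumFields.YangMills.Theorems.FemtoTransferGap

/-- **The magnetic IMS phase** `Φ_η(U) = (π/2)·clamp01(S(U)/η − 1)`. [cite: SimonB1983DiscreteSpectrum, §3] -/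
def magPhase (η : ℝ) (U : Cfg) : ℝ :=
  Real.pi / 2 * clamp01 (wilsonAction su2Rep U / η - 1)

end Summit.QuantumFields.YangMills.Theorems.FemtoTransferGap

end
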